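import Literature.NumberTheory.ComplexMultiplication.WeilTorusToSerreGroup
import Mathlib.NumberTheory.NumberField.ClassNumber
import Mathlib.NumberTheory.RamificationInertia.Basic
import HarnessLib

/-!
# Milne 1999 §5 «THE MAP `P → S`», the choice of `ϖ`: a generator of `𝔭_{w₀}^h` (`h` the order of `[𝔭_{w₀}]` in the class
# group) is an integer of norm `p^{f(𝔭_{w₀}/p)h}`, and the resulting homomorphism `g ↦ [g(ϖ)] : X^*(S^K) → W(p^∞)` — hence
# `α^K_{w₀} : (P, p) → (S^K, s^K)` — does not depend on the choice of `ϖ`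
# (J. S. Milne, *Lefschetz motives and the Tate conjecture*, Compositio Math. 117 (1999), §5 p. 63 L1–L9)

Family `hodge`, lane `lit-hodgefound` (Layer A3; seat `lit-hodgefound-p27`, generation 15, row g15-#5); topic
`Literature/NumberTheory/ComplexMultiplication`, namespace `Literature.NumberTheory.ComplexMultiplication.CMNumbers`.  FOURTH FILE of
the seat's Milne-1999 series; direct sequel of g15-#4 `WeilTorusToSerreGroup.lean`, which built `g(a)`, `[g(a)] ∈ W(p^∞)` and
`α^K : P(R) → S^K(R)` for an ABSTRACT datum `ϖ : PPowNormElt K p` (`ϖ ∈ 𝓞_K`, `Nm ϖ = p^k`) and proved `alphaChar ϖ′ = alphaChar ϖ`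
when `ϖ′ = ϖu` for a unit `u`.  Here the datum is PRODUCED from a prime `𝔭 = 𝔭_{w₀}` of `K` over `p` exactly as printed, with
Mathlib's class group (`ClassGroup (𝓞 K)`, finite: `ClassNumber`), ideal norm (`Ideal.absNorm`, `absNorm_eq_pow_inertiaDeg'`) and
residue degree (`Ideal.inertiaDeg'`).  Small carriers with bodies (`classOrder`, `primePowGenerator`, `PPowNormElt.ofPrime`,
`alphaCharOfPrime`, `alphaPointsOfPrime`) + THEOREMS; no named fact (D-0026, net debt 0).

THE PRINT.  [Milne1999] §5 p. 63 L1–L9 (held `paper:doi-10-1023-a-1000776613765` p0019), verbatim: «Let `ϖ` generate the ideal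
`𝔭_{w₀}^h`, where `h` is the order of the prime ideal `𝔭_{w₀}` corresponding to `w₀` in the class group of `K`. According to the
above remarks, `g(ϖ)` is independent of the choice of `ϖ` up to a root of unity, and it is a Weil `p^{f(𝔭_{w₀}/p)h}`-number of
weight `wt(g)`. … The class it represents in `W^K(p^∞)` is independent of the choice of `ϖ`, and so we have a homomorphism
`g ↦ [g(ϖ)] : X^*(S^K) → W^K(p^∞)`. We sometimes denote this map as `g ↦ π(g)`. It commutes with the action of `Γ`, and so
defines a homomorphism `α^K : P^K → S^K`.»; Remark 5.2 (c): «The homomorphism `α^K : P^K → S^K` sends `p^K` to `s^K`.»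

DICTIONARY.  `K` a CM field (Mathlib `IsCMField K`; Milne: «a CM-field `K ⊂ ℚ^{al}` of finite degree and Galois over `ℚ`» — the
Galois hypothesis is not needed for this construction), `w₀ ↔ 𝔭 : Ideal (𝓞 K)` a prime over `p` (`𝔭.LiesOver (p)`),
`h = classOrder p 𝔭 = orderOf [𝔭]`, `f(𝔭/p) = (p).inertiaDeg' 𝔭`, `ϖ = primePowGenerator p 𝔭` (Mathlib's `IsPrincipal.generator` of
`𝔭^h`), `Nm_{K/ℚ}(ϖ) = p^{fh}` (`norm_primePowGenerator`; positivity of norms in CM fields, §1), `PPowNormElt.ofPrime p 𝔭` = the datum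
of g15-#4 with level `k = f·h`; `α^K_{w₀} = alphaCharOfPrime p 𝔭 / alphaPointsOfPrime p 𝔭 R` (g15-#4's `alphaChar`/`alphaPoints` at
`ofPrime p 𝔭`); `𝔭` is assumed prime and over `p` (`[𝔭.IsPrime] [𝔭.LiesOver (p)]`).  As in g15-#4, Milne's `W^K(p^∞) ⊂ W(p^∞)` and `P^K` are not separated: the maps land in `W(p^∞) = X^*(P)`, `P → S^K`.

WHAT IS HERE (all PROVED):
* §1 `norm_pos_of_isCMField` — private plumbing: `Nm_{K/ℚ}(x) > 0` for `x ≠ 0` in a CM field (`Nm_{K/ℚ} = Nm_{K⁺/ℚ} ∘ Nm_{K/K⁺}`,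
  `Nm_{K/K⁺}(x) = x·x̄`, and every complex embedding of `K⁺` sends `x x̄` to `|Φx|² > 0`).
* §2 `ne_bot_of_liesOver`, DEF `classOrder p 𝔭 = h` («the order of `𝔭_{w₀}` in the class group of `K`»), `classOrder_pos`, **`isPrincipal_pow_classOrder`**
  (`𝔭^h` is principal), DEF **`primePowGenerator 𝔭 = ϖ`** with **`span_primePowGenerator : (ϖ) = 𝔭^h`** («Let `ϖ` generate the ideal
  `𝔭_{w₀}^h`»), `primePowGenerator_ne_zero`, **`natAbs_norm_primePowGenerator` / `norm_primePowGenerator : Nm_{K/ℚ}(ϖ) = p^{f(𝔭/p)h}`**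
  (`absNorm 𝔭 = p^f`), DEF `primeLevel p 𝔭 = f·h ∈ ℕ≥1`, DEF **`PPowNormElt.ofPrime p 𝔭`** (g15-#4's datum, level `f·h`), so that by g15-#4 **`g(ϖ)` IS A WEIL
  `p^{f(𝔭/p)h}`-NUMBER OF WEIGHT `wt(g)`** (`isWeilNumber_serreCharEval_primePowGenerator`).
* §3 **`alphaChar_eq_of_span_eq`**: ANY datum `ϖ′` generating the same ideal `𝔭^h` gives the same `g ↦ [g(ϖ′)]` («The class it
  represents in `W(p^∞)` is independent of the choice of `ϖ`»: two generators are associated, g15-#4 `alphaChar_eq_of_elt_eq_mul_unit`);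
  DEF **`alphaCharOfPrime 𝔭 : X^*(S^K) →ₗ[ℤ] X^*(P)`** — THE CANONICAL `g ↦ π(g) = [g(ϖ)]` of `(K, w₀)`, `alphaCharOfPrime_infinityTypesRep`
  («commutes with the action of `Γ`»), `weilLimExp_alphaCharOfPrime` (weight `wt(g)`), **`alphaCharOfPrime_constChar_one : s^K ↦ [p]`**;
  DEF **`alphaPointsOfPrime 𝔭 R : P(R) →* S^K(R)`** («defines a homomorphism `α^K : P^K → S^K`»), `map_alphaPointsOfPrime`,
  **`eval_constChar_alphaPointsOfPrime`** (Remark 5.2 (c): `s^K ∘ α^K = p`).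

NOT here: (5.1) `f_{g(ϖ)}(w) = Σ_{τw₀ = w} g(τ)`, `g(ϖ) ∈ W^K(p^{f(w₀/p)})`, Lemma 5.1, Remark 5.2 (a)(b) (injectivity; `α : P → S` at
the limit over `K`), `W^K`/`P^K` — later rows; Thm. 5.4 — Layer B.

## References

* [Milne1999] J. S. Milne, *Lefschetz motives and the Tate conjecture*, Compositio Math. 117 (1999) 45–76 — §5 «The map P → S»
  p. 63 L1–L9 and Remark 5.2 (c) (held `paper:doi-10-1023-a-1000776613765` p0019).
* [MilneCM2006] J. S. Milne, *Complex Multiplication* (course notes), Ch. I §4 (the Serre group; skel-3's files).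

Provenance: lane `lit-hodgefound`, seat `lit-hodgefound-p27` gen 15 (agent `literature-prover-lit-hodgefound-p27-g15-0`),
row g15-#5 (INBOX 2026-08-23T01:50:19Z l.5749).
-/

set_option autoImplicit false

noncomputable section

open scoped TensorProduct NumberField ComplexConjugate

namespace Literature.NumberTheory.ComplexMultiplication

namespace CMNumbers

open _root_.NumberField
open Literature.NumberTheory.NumberFields (cmNumbers cmNumbersConj cmNumbersConj_mul_self cmNumbersConj_mul_comm)
open Literature.RingTheory.GaloisAlgebras.CharacterModuleTorus (torusPoints galUnits)
open SerreGroupTorus (infinityTypesRep coe_infinityTypesRep_apply constChar coe_constChar serrePoints)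

variable {K : Type} [Field K] [NumberField K]

/-! ### §1 Norms from a CM field are positive -/

/-- In a CM field `K` with maximal real subfield `K⁺`, `Nm_{K/K⁺}(x) = x·x̄` (`Gal(K/K⁺) = {1, ι}`). [folklore] -/
private theorem algebraMap_norm_maximalRealSubfield [IsCMField K] (x : K) :
    algebraMap (maximalRealSubfield K) K (Algebra.norm (maximalRealSubfield K) x) = x * IsCMField.complexConj K x := by
  classical
  rw [Algebra.norm_eq_prod_automorphisms]
  have hcard : Fintype.card (K ≃ₐ[maximalRealSubfield K] K) = 2 := by
    rw [← Nat.card_eq_fintype_card, IsGalois.card_aut_eq_finrank, Algebra.IsQuadraticExtension.finrank_eq_two]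
  have hne : (1 : K ≃ₐ[maximalRealSubfield K] K) ≠ IsCMField.complexConj K := (IsCMField.complexConj_ne_one K).symm
  have huniv : (Finset.univ : Finset (K ≃ₐ[maximalRealSubfield K] K)) = {1, IsCMField.complexConj K} :=
    (Finset.eq_univ_of_card _ (by rw [Finset.card_pair hne, hcard])).symm
  rw [huniv, Finset.prod_pair hne, AlgEquiv.one_apply]

/-- **The norm of a non-zero element of a CM field is POSITIVE**: `Nm_{K/ℚ}(x) = Nm_{K⁺/ℚ}(x x̄)` and every complex embedding of `K⁺`
sends `x x̄` to `|Φ x|² > 0` for an extension `Φ` of it to `K` (plumbing for `norm_primePowGenerator`). [folklore] -/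
private theorem norm_pos_of_isCMField [IsCMField K] {x : K} (hx : x ≠ 0) : 0 < Algebra.norm ℚ x := by
  classical
  rw [← Algebra.norm_norm (S := maximalRealSubfield K)]
  set y : maximalRealSubfield K := Algebra.norm (maximalRealSubfield K) x with hy_def
  have hy : algebraMap (maximalRealSubfield K) K y = x * IsCMField.complexConj K x := algebraMap_norm_maximalRealSubfield x
  -- every complex embedding of `K⁺` sends `y` to a positive real
  have key : ∀ φ : maximalRealSubfield K →ₐ[ℚ] ℂ, ∃ r : ℝ, 0 < r ∧ (φ y : ℂ) = r := by
    intro φ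
    letI : Algebra (maximalRealSubfield K) ℂ := φ.toRingHom.toAlgebra
    let Φ : K →ₐ[maximalRealSubfield K] ℂ := IsAlgClosed.lift
    have hΦ : Φ (algebraMap (maximalRealSubfield K) K y) = φ y := Φ.commutes y
    refine ⟨Complex.normSq (Φ x), Complex.normSq_pos.mpr ((map_ne_zero Φ).mpr hx), ?_⟩
    rw [← hΦ, hy, map_mul, ← Complex.mul_conj]
    congr 1
    exact IsCMField.complexEmbedding_complexConj (φ := Φ.toRingHom) (x := x)
  choose r hr0 hr using key
  have hprod := Algebra.norm_eq_prod_embeddings ℚ ℂ y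
  rw [Finset.prod_congr rfl (fun φ _ => hr φ), ← Complex.ofReal_prod, eq_ratCast, ← Complex.ofReal_ratCast] at hprod
  have h2 : ((Algebra.norm ℚ y : ℚ) : ℝ) = ∏ φ, r φ := Complex.ofReal_injective hprod
  exact_mod_cast h2 ▸ Finset.prod_pos fun φ _ => hr0 φ

/-! ### §2 «Let `ϖ` generate the ideal `𝔭_{w₀}^h`»: the datum `PPowNormElt.ofPrime` -/

section OfPrime

variable (p : ℕ) [hp : Fact p.Prime] (𝔭 : Ideal (𝓞 K)) [h𝔭 : 𝔭.LiesOver (Ideal.span {(p : ℤ)})]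

include hp h𝔭 in
/-- An ideal lying over `(p)`, `p` prime, is non-zero. [cite: Milne1999, §5 p. 63 L1–L2] -/
theorem ne_bot_of_liesOver : 𝔭 ≠ ⊥ := by
  intro h
  have h1 : Ideal.span {(p : ℤ)} = ⊥ := by
    rw [h𝔭.over, h, Ideal.under_def, Ideal.comap_bot_of_injective _ (algebraMap ℤ (𝓞 K)).injective_int]
  exact (Int.natCast_ne_zero.mpr hp.out.ne_zero) (Ideal.span_singleton_eq_bot.mp h1)

include hp h𝔭 in
/-- `𝔭` as a non-zero-divisor of the monoid of ideals (the class group is `(Ideal 𝓞_K)⁰/≈`). [cite: Milne1999, §5 p. 63 L1–L2] -/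
theorem mem_nonZeroDivisors_of_liesOver : 𝔭 ∈ nonZeroDivisors (Ideal (𝓞 K)) :=
  mem_nonZeroDivisors_iff_ne_zero.mpr (by rw [Ne, Ideal.zero_eq_bot]; exact ne_bot_of_liesOver p 𝔭)

/-- **`h`, «the order of the prime ideal `𝔭_{w₀}` … in the class group of `K`»** (finite: Mathlib's `ClassNumber`).
[cite: Milne1999, §5 p. 63 L1–L2] -/
def classOrder : ℕ := orderOf (ClassGroup.mk0 ⟨𝔭, mem_nonZeroDivisors_of_liesOver p 𝔭⟩)

/-- `h ≥ 1`. [cite: Milne1999, §5 p. 63 L1–L2] -/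
theorem classOrder_pos : 0 < classOrder p 𝔭 := orderOf_pos _

/-- **`𝔭^h` is principal.** [cite: Milne1999, §5 p. 63 L1–L2] -/
theorem isPrincipal_pow_classOrder : (𝔭 ^ classOrder p 𝔭).IsPrincipal := by
  have h : ClassGroup.mk0 ⟨𝔭 ^ classOrder p 𝔭, pow_mem (mem_nonZeroDivisors_of_liesOver p 𝔭) _⟩ = 1 := by
    rw [← SubmonoidClass.mk_pow, map_pow]
    exact pow_orderOf_eq_one _
  exact (ClassGroup.mk0_eq_one_iff _).mp h

/-- **`ϖ`: «Let `ϖ` generate the ideal `𝔭_{w₀}^h`»** — a generator of the principal ideal `𝔭^h` (Mathlib's `IsPrincipal.generator`).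
[cite: Milne1999, §5 p. 63 L1] -/
def primePowGenerator : 𝓞 K :=
  @Submodule.IsPrincipal.generator _ _ _ _ _ (𝔭 ^ classOrder p 𝔭) (isPrincipal_pow_classOrder p 𝔭)

/-- `(ϖ) = 𝔭^h`. [cite: Milne1999, §5 p. 63 L1] -/
theorem span_primePowGenerator : Ideal.span {primePowGenerator p 𝔭} = 𝔭 ^ classOrder p 𝔭 :=
  @Ideal.span_singleton_generator _ _ (𝔭 ^ classOrder p 𝔭) (isPrincipal_pow_classOrder p 𝔭)

/-- `ϖ ≠ 0`. [cite: Milne1999, §5 p. 63 L1] -/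
theorem primePowGenerator_ne_zero : primePowGenerator p 𝔭 ≠ 0 := by
  intro h
  have h1 := span_primePowGenerator p 𝔭
  rw [h, Ideal.span_singleton_eq_bot.mpr rfl] at h1
  have h2 : 𝔭 ^ classOrder p 𝔭 ≠ ⊥ := by
    rw [← Ideal.zero_eq_bot]
    exact pow_ne_zero _ (by rw [Ideal.zero_eq_bot]; exact ne_bot_of_liesOver p 𝔭)
  exact h2 h1.symm

/-- **`|Nm(ϖ)| = p^{f(𝔭/p)·h}`** (`N(ϖ) = N𝔭^h` and `N𝔭 = p^{f}`, Mathlib `absNorm_eq_pow_inertiaDeg'`). [cite: Milne1999, §5 p. 63 L2–L3] -/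
theorem natAbs_norm_primePowGenerator :
    (Algebra.norm ℤ (primePowGenerator p 𝔭)).natAbs = p ^ ((Ideal.span {(p : ℤ)}).inertiaDeg' 𝔭 * classOrder p 𝔭) := by
  rw [← Ideal.absNorm_span_singleton, span_primePowGenerator, map_pow, Ideal.absNorm_eq_pow_inertiaDeg' 𝔭 hp.out, ← pow_mul]

/-- **`Nm_{K/ℚ}(ϖ) = p^{f(𝔭/p)·h}`** for `K` CM (norms from CM fields are positive, §1) — so `g(ϖ)` will be «a Weil
`p^{f(𝔭_{w₀}/p)h}`-number». [cite: Milne1999, §5 p. 63 L2–L3] -/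
theorem norm_primePowGenerator [IsCMField K] :
    Algebra.norm ℚ ((primePowGenerator p 𝔭 : 𝓞 K) : K) = (p : ℚ) ^ ((Ideal.span {(p : ℤ)}).inertiaDeg' 𝔭 * classOrder p 𝔭) := by
  have hpos : 0 < Algebra.norm ℚ ((primePowGenerator p 𝔭 : 𝓞 K) : K) :=
    norm_pos_of_isCMField (RingOfIntegers.coe_ne_zero_iff.mpr (primePowGenerator_ne_zero p 𝔭))
  rw [← Algebra.coe_norm_int] at hpos ⊢
  have h0 : 0 ≤ Algebra.norm ℤ (primePowGenerator p 𝔭) := le_of_lt (by exact_mod_cast hpos)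
  have h3 : Algebra.norm ℤ (primePowGenerator p 𝔭) =
      ((p ^ ((Ideal.span {(p : ℤ)}).inertiaDeg' 𝔭 * classOrder p 𝔭) : ℕ) : ℤ) := by
    rw [Int.eq_natAbs_of_nonneg h0, natAbs_norm_primePowGenerator]
  rw [h3]
  push_cast
  rfl

variable [h𝔭P : 𝔭.IsPrime]

/-- The level `k = f(𝔭/p)·h ≥ 1` of `ϖ` (`f ≥ 1` as `𝔭` is a prime over `p`). [cite: Milne1999, §5 p. 63 L2–L3] -/
def primeLevel : ℕ+ :=
  ⟨(Ideal.span {(p : ℤ)}).inertiaDeg' 𝔭 * classOrder p 𝔭,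
    Nat.mul_pos (Ideal.inertiaDeg'_pos' (Ideal.span {(p : ℤ)}) 𝔭) (classOrder_pos p 𝔭)⟩

/-- [cite: Milne1999, §5 p. 63 L2–L3] -/
@[simp] theorem coe_primeLevel : ((primeLevel p 𝔭 : ℕ+) : ℕ) = (Ideal.span {(p : ℤ)}).inertiaDeg' 𝔭 * classOrder p 𝔭 := rfl

/-- **THE DATUM `ϖ` OF g15-#4 PRODUCED FROM THE PRIME `𝔭 = 𝔭_{w₀}`** (for `K` CM): `ϖ ∈ 𝓞_K` a generator of `𝔭^h`, of norm `p^{fh}`.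
[cite: Milne1999, §5 p. 63 L1–L3] -/
def PPowNormElt.ofPrime [IsCMField K] : PPowNormElt K p where
  elt := ((primePowGenerator p 𝔭 : 𝓞 K) : K)
  level := primeLevel p 𝔭
  isIntegral_elt := RingOfIntegers.isIntegral_coe _
  norm_elt := norm_primePowGenerator p 𝔭

/-- [cite: Milne1999, §5 p. 63 L1–L3] -/
@[simp] theorem PPowNormElt.ofPrime_elt [IsCMField K] :
    (PPowNormElt.ofPrime p 𝔭).elt = ((primePowGenerator p 𝔭 : 𝓞 K) : K) := rfl

/-- [cite: Milne1999, §5 p. 63 L1–L3] -/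
@[simp] theorem PPowNormElt.ofPrime_level [IsCMField K] :
    (PPowNormElt.ofPrime p 𝔭).level = primeLevel p 𝔭 := rfl

/-- **«`g(ϖ)` … is a Weil `p^{f(𝔭_{w₀}/p)h}`-number of weight `wt(g)`»** — g15-#4's `isWeilNumber_serreCharEval` at the datum `ofPrime 𝔭`.
[cite: Milne1999, §5 p. 63 L2–L3] -/
theorem isWeilNumber_serreCharEval_primePowGenerator [IsCMField K] {g : (K →ₐ[ℚ] cmNumbers) → ℤ}
    (hg : g ∈ infinityTypes (cmNumbers ≃ₐ[ℚ] cmNumbers) (K →ₐ[ℚ] cmNumbers) cmNumbersConj) (τ₀ : K →ₐ[ℚ] cmNumbers) :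
    IsWeilNumber p ((Ideal.span {(p : ℤ)}).inertiaDeg' 𝔭 * classOrder p 𝔭) (-weight cmNumbersConj τ₀ g)
      ((serreCharEval g (PPowNormElt.ofPrime p 𝔭).unit : cmNumbersˣ) : cmNumbers) :=
  isWeilNumber_serreCharEval (Or.inr ‹_›) hg τ₀ (PPowNormElt.ofPrime p 𝔭).isIntegral_elt (norm_primePowGenerator p 𝔭)

end OfPrime

/-! ### §3 «independent of the choice of `ϖ`»: the canonical `α^K_{w₀} : (P, p) → (S^K, s^K)` -/

section Alpha

variable [IsCMField K] (p : ℕ) [hp : Fact p.Prime] (𝔭 : Ideal (𝓞 K)) [h𝔭 : 𝔭.LiesOver (Ideal.span {(p : ℤ)})] [h𝔭P : 𝔭.IsPrime]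

/-- **«The class it represents in `W(p^∞)` is independent of the choice of `ϖ`»**: any datum `ϖ′ ∈ 𝓞_K` generating the SAME
ideal `𝔭^h` gives the same homomorphism `g ↦ [g(ϖ′)]` as `ϖ = primePowGenerator 𝔭` (two generators are associated, i.e. differ by
a unit, and g15-#4's `alphaChar_eq_of_elt_eq_mul_unit`). [cite: Milne1999, §5 p. 63 L2–L7] -/
theorem alphaChar_eq_of_span_eq (ϖ' : PPowNormElt K p) (x : 𝓞 K) (hx : (x : K) = ϖ'.elt)
    (hspan : Ideal.span {x} = 𝔭 ^ classOrder p 𝔭) :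
    alphaChar (Or.inr ‹IsCMField K›) ϖ' = alphaChar (Or.inr ‹IsCMField K›) (PPowNormElt.ofPrime p 𝔭) := by
  rw [← span_primePowGenerator p 𝔭, Ideal.span_singleton_eq_span_singleton] at hspan
  obtain ⟨u, hu⟩ := hspan.symm
  -- `x = ϖ u`
  refine alphaChar_eq_of_elt_eq_mul_unit (Or.inr ‹IsCMField K›) (PPowNormElt.ofPrime p 𝔭) ϖ' u ?_
  rw [← hx, ← hu, PPowNormElt.ofPrime_elt, RingOfIntegers.coe_eq_algebraMap, map_mul, ← RingOfIntegers.coe_eq_algebraMap]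

/-- **THE CANONICAL HOMOMORPHISM `g ↦ π(g) = [g(ϖ)] : X^*(S^K) → W(p^∞) = X^*(P)` OF `(K, w₀)`** («we have a homomorphism
`g ↦ [g(ϖ)] : X^*(S^K) → W^K(p^∞)`»): g15-#4's `alphaChar` at the datum `ofPrime 𝔭`; by `alphaChar_eq_of_span_eq` it does not
depend on the generator. [cite: Milne1999, §5 p. 63 L6–L8] -/
def alphaCharOfPrime :
    infinityTypes (cmNumbers ≃ₐ[ℚ] cmNumbers) (K →ₐ[ℚ] cmNumbers) cmNumbersConj →ₗ[ℤ] Additive (WeilLimit p) :=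
  alphaChar (Or.inr ‹IsCMField K›) (PPowNormElt.ofPrime p 𝔭)

/-- Unfolding: `alphaCharOfPrime p 𝔭 g = [g(ϖ)]`, `ϖ = primePowGenerator 𝔭`. [cite: Milne1999, §5 p. 63 L6–L8] -/
theorem alphaCharOfPrime_apply (g : infinityTypes (cmNumbers ≃ₐ[ℚ] cmNumbers) (K →ₐ[ℚ] cmNumbers) cmNumbersConj) :
    alphaCharOfPrime p 𝔭 g =
      Additive.ofMul (weilGerm (primeLevel p 𝔭) (alphaUnit (Or.inr ‹IsCMField K›) (PPowNormElt.ofPrime p 𝔭) g)) := rfl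

/-- **«It commutes with the action of `Γ`»** (so it «defines a homomorphism `α^K : P^K → S^K`»). [cite: Milne1999, §5 p. 63 L8–L9] -/
theorem alphaCharOfPrime_infinityTypesRep (σ : cmNumbers ≃ₐ[ℚ] cmNumbers)
    (g : infinityTypes (cmNumbers ≃ₐ[ℚ] cmNumbers) (K →ₐ[ℚ] cmNumbers) cmNumbersConj) :
    alphaCharOfPrime p 𝔭 (infinityTypesRep (cmNumbers ≃ₐ[ℚ] cmNumbers) (K →ₐ[ℚ] cmNumbers) cmNumbersConj σ g) =
      weilLimRep p σ (alphaCharOfPrime p 𝔭 g) :=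
  alphaChar_infinityTypesRep _ _ σ g

/-- `π(g) = [g(ϖ)]` has weight `wt(g)`. [cite: Milne1999, §5 p. 63 L2–L3] -/
theorem weilLimExp_alphaCharOfPrime (g : infinityTypes (cmNumbers ≃ₐ[ℚ] cmNumbers) (K →ₐ[ℚ] cmNumbers) cmNumbersConj)
    (τ₀ : K →ₐ[ℚ] cmNumbers) :
    weilLimExp (Additive.toMul (alphaCharOfPrime p 𝔭 g)) = -weight cmNumbersConj τ₀ (g : (K →ₐ[ℚ] cmNumbers) → ℤ) :=
  weilLimExp_alphaChar _ _ g τ₀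

/-- **Remark 5.2 (c) on characters: `s^K ↦ [p]`.** [cite: Milne1999, §5 p. 63 Rem. 5.2 (c)] -/
theorem alphaCharOfPrime_constChar_one :
    alphaCharOfPrime p 𝔭 (constChar (cmNumbers ≃ₐ[ℚ] cmNumbers) (K →ₐ[ℚ] cmNumbers) cmNumbersConj 1) =
      Additive.ofMul (pGerm : WeilLimit p) :=
  alphaChar_constChar_one _ _

variable (R : Type*) [CommRing R] [Algebra ℚ R]

/-- **`α^K_{w₀}(R) : P(R) → S^K(R)`** — «defines a homomorphism `α^K : P^K → S^K`» — g15-#4's `alphaPoints` at `ofPrime 𝔭`.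
[cite: Milne1999, §5 p. 63 L8–L9] -/
def alphaPointsOfPrime : weilTorusPoints p R →* serrePoints ℚ cmNumbers K cmNumbersConj R :=
  alphaPoints (Or.inr ‹IsCMField K›) (PPowNormElt.ofPrime p 𝔭) R

variable {R} in
/-- Values: `α(f)(g) = f([g(ϖ)])`. [cite: Milne1999, §5 p. 63 L8–L9] -/
theorem alphaPointsOfPrime_apply_ofAdd (f : weilTorusPoints p R)
    (g : infinityTypes (cmNumbers ≃ₐ[ℚ] cmNumbers) (K →ₐ[ℚ] cmNumbers) cmNumbersConj) :
    (alphaPointsOfPrime p 𝔭 R f : Multiplicative (infinityTypes (cmNumbers ≃ₐ[ℚ] cmNumbers) (K →ₐ[ℚ] cmNumbers) cmNumbersConj) →*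
        (cmNumbers ⊗[ℚ] R)ˣ) (Multiplicative.ofAdd g) =
      germChar (Additive.toMul (alphaCharOfPrime p 𝔭 g)) f := rfl

variable {R} {R' : Type*} [CommRing R'] [Algebra ℚ R'] in
/-- `α^K_{w₀}` is natural in `R`. [cite: Milne1999, §5 p. 63 L8–L9] -/
theorem map_alphaPointsOfPrime (φ : R →ₐ[ℚ] R') (f : weilTorusPoints p R) :
    torusPoints.map ℚ cmNumbers R (infinityTypesRep (cmNumbers ≃ₐ[ℚ] cmNumbers) (K →ₐ[ℚ] cmNumbers) cmNumbersConj) R' φ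
        (alphaPointsOfPrime p 𝔭 R f) =
      alphaPointsOfPrime p 𝔭 R' (torusPoints.map ℚ cmNumbers R (weilLimRep p) R' φ f) := rfl

variable {R} in
/-- **Remark 5.2 (c): «`α^K` sends `p^K` to `s^K`»** — on points `s^K(α^K_{w₀}(f)) = p(f)`. [cite: Milne1999, §5 p. 63 Rem. 5.2 (c)] -/
theorem eval_constChar_alphaPointsOfPrime (f : weilTorusPoints p R) :
    torusPoints.eval ℚ cmNumbers R (infinityTypesRep (cmNumbers ≃ₐ[ℚ] cmNumbers) (K →ₐ[ℚ] cmNumbers) cmNumbersConj)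
        (constChar (cmNumbers ≃ₐ[ℚ] cmNumbers) (K →ₐ[ℚ] cmNumbers) cmNumbersConj 1) (alphaPointsOfPrime p 𝔭 R f) =
      germChar pGerm f :=
  eval_constChar_alphaPoints _ _ f

end Alpha

end CMNumbers

end Literature.NumberTheory.ComplexMultiplication

end
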